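/-
Copyright (c) 2026 the pub-hodgecm-mathlib formalisation cell (harness21).  Prover seat hodgecm-mathlib-K2Liu-p13 (g2), Track B «K2-LIT»,
#184♮ = hLiu418 = `stmt-HodgeConjecture-24832`; Road I v3 organ U1-CT-ind STAGE 2 (Q2), file F11 (the last scalar modulus `D_Y(a)` of ★ F5-n ∕ ★ F5-c's law).
-/
import Literature.NumberTheory.Automorphic.UnitaryGroupTraceZeroLineHaar          -- ★ `traceZeroAdele`, `smulTraceZero`, `map_smulTraceZero_eq`, `exists_traceZeroModulus_eq_ideleNorm`
import Literature.NumberTheory.AdelicBaseChange.IdeleNormModule                     -- ★ `ideleNorm_ideleBaseChange`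
import Literature.NumberTheory.Automorphic.IdeleClassCharacterAlgebraicTwist        -- ★ `ideleNorm_galSMul`
import Literature.NumberTheory.Automorphic.AdicCompletionCompact                    -- ★ `locallyCompactSpace_adeleRing'`
import Literature.NumberTheory.Weil1982.UnitaryLocalRingBaseField                  -- ★ `exists_complexConj_eq_neg_ne_zero`
import Mathlib.NumberTheory.NumberField.CMField
import HarnessLib

/-!
# Crux `HLiu418`, Road I v3, organ U1 stage 2 (Q2), file F11: THE MODULUS OF `y ↦ a⁻¹σ(a⁻¹)·y` ON THE SKEW LINE `𝔸_L⁻` IS `‖a‖_{𝔸_L}` —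
# ★ F5-n's `D_Y(a)` from the tree's trace-zero line dictionary (★ `UnitaryGroupTraceZeroLineHaar`: `traceZeroModulus (a₀ ⊗ 1) = ‖a₀‖_{𝔸_{L⁺}}`)

Cell `hodgecm-mathlib`, crux item hLiu418 = `stmt-HodgeConjecture-24832`; squad K2 ∕ K2Liu; LEAD F0P6-plan (g14), co-dealer K2E5-plan (g7); prover K2Liu-p13 (g2).
THEOREMS ONLY (no `def`, no instance, no notation, no named-fact hypothesis, no `sorry`); lane `--supports stmt-HodgeConjecture-24832 --as helper` (count-neutral).
With `Y := traceZeroAdele L⁺ L c` (★ `UnitaryGroupGlobalGenericity`; its membership law `mem_traceZeroAdele_iff` is ★ F5-c…F10's `hY`) and `u := a⁻¹·(c•a⁻¹)` (`c`-fixed):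
★ `map_smulTraceZero_eq` gives `(u·)_*μ_Y = (traceZeroModulus u)⁻¹ μ_Y`; ★ `exists_traceZeroModulus_eq_ideleNorm` gives `traceZeroModulus u = ‖a₀‖_{L⁺}` with `a₀ ⊗ 1 = u`; and
`‖a₀‖_{L⁺}² = ‖a₀ ⊗ 1‖_L = ‖a⁻¹‖_L·‖c•a⁻¹‖_L = ‖a⁻¹‖_L²` (★ `ideleNorm_ideleBaseChange`, ★ `ideleNorm_galSMul`), so `traceZeroModulus u = ‖a⁻¹‖_L` and
* **`map_scaleY_eq_ideleNorm_smul`**: `(y ↦ a⁻¹σ(a⁻¹)·y)_*μ_Y = ‖a‖_{𝔸_L} · μ_Y` for every additive Haar measure `μ_Y` on `𝔸_L⁻` (regular) — ★ F5-n `klingenInner_hscale`'s `hYs` with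
  `D_Y = ‖a‖_{𝔸_L}` (so, with ★ F5-o's `D_T = ‖a‖‖b₀₀‖⁻¹`, ★ F5-c's `δ_{a,b} = ‖a‖²_{𝔸_L}‖b₀₀‖⁻¹_{𝔸_L}`: the cuspidal exponent of term 2).
[CasselsFrohlichANT1967, Ch. XV Lemma 4.1.2, Ch. II §11], [WeilBNT1967, Ch. IV §3], [MoeglinWaldspurger1995, II.1.7].
HONEST LABEL.  Count-neutral helper: `HC_CM` is proved only modulo the 7 printed citations (2 remaining named inputs: hLiu418 = `stmt-HodgeConjecture-24832`,
h413 = `stmt-HodgeConjecture-24833`) until rung 0 closes.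
-/

set_option autoImplicit false
set_option linter.dupNamespace false -- the mandated namespace repeats `HodgeConjecture.HodgeConjecture`

noncomputable section

open scoped ENNReal NNReal
open NumberField IsDedekindDomain MeasureTheory MeasureTheory.Measure

namespace Summit.HodgeConjecture.HodgeConjecture.Cruxes.HLiu418.K2LiuSkewLineModulus

open Literature.NumberTheory.Automorphic Literature.NumberTheory.Automorphic.UnitaryGroup
open Literature.NumberTheory.GaloisRepresentations

variable {L : Type} [Field L] [NumberField L] [IsCMField L]

/-- the idele `u = a⁻¹·(c • a⁻¹)` is `c`-fixed. [folklore] -/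
theorem conjAdele_normInv_eq (a : (AdeleRing (𝓞 L) L)ˣ) :
    conjAdele (↥(maximalRealSubfield L)) L (IsCMField.complexConj L) (((a⁻¹ * IsCMField.complexConj L • a⁻¹ : (AdeleRing (𝓞 L) L)ˣ)) : AdeleRing (𝓞 L) L) =
      ((a⁻¹ * IsCMField.complexConj L • a⁻¹ : (AdeleRing (𝓞 L) L)ˣ) : AdeleRing (𝓞 L) L) := by
  rw [Units.val_mul, AdeleRing.coe_smul_units, map_mul, conjAdele_apply, conjAdele_apply, smul_smul,
    show IsCMField.complexConj L * IsCMField.complexConj L = 1 from AlgEquiv.ext fun y => IsCMField.complexConj_apply_apply L y, one_smul, mul_comm]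

/-- `‖a₀‖_{L⁺} = ‖a⁻¹‖_L` when `a₀ ⊗ 1 = a⁻¹·(c•a⁻¹)` (`‖a₀ ⊗ 1‖_L = ‖a₀‖²_{L⁺}`, `‖c•x‖ = ‖x‖`). [cite: CasselsFrohlichANT1967, Ch. II §11] -/
theorem ideleNorm_eq_of_ideleBaseChange_eq (a : (AdeleRing (𝓞 L) L)ˣ) (a₀ : (AdeleRing (𝓞 (↥(maximalRealSubfield L))) (↥(maximalRealSubfield L)))ˣ)
    (h : AdeleRing.ideleBaseChange (↥(maximalRealSubfield L)) L a₀ = a⁻¹ * IsCMField.complexConj L • a⁻¹) :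
    IdeleClassGroup.ideleNorm (↥(maximalRealSubfield L)) a₀ = IdeleClassGroup.ideleNorm L a⁻¹ := by
  have h1 := Literature.NumberTheory.AdelicBaseChange.ideleNorm_ideleBaseChange (K := ↥(maximalRealSubfield L)) (L := L) a₀
  rw [h, map_mul, Algebra.IsQuadraticExtension.finrank_eq_two (↥(maximalRealSubfield L)) L] at h1
  have h2 : IdeleClassGroup.ideleNorm L (IsCMField.complexConj L • a⁻¹) = IdeleClassGroup.ideleNorm L a⁻¹ := by
    apply NNReal.coe_injective
    rw [coe_ideleNorm, coe_ideleNorm]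
    exact ideleNorm_galSMul (IsCMField.complexConj L) a⁻¹
  rw [h2, ← sq] at h1
  exact (pow_left_injective two_ne_zero h1).symm

/-- **(Q2) F11 — THE MODULUS OF THE SKEW-LINE SCALING `y ↦ a⁻¹σ(a⁻¹)·y` IS `‖a‖_{𝔸_L}`** (★ F5-n's `D_Y(a)`): for every regular additive Haar measure `μ_Y` on the
trace-zero adeles `𝔸_L⁻ = traceZeroAdele L⁺ L c` and every membership witness `hmem`,
`(y ↦ ⟨a⁻¹σ(a⁻¹)·y, hmem y⟩)_*μ_Y = ‖a‖_{𝔸_L} · μ_Y`. [cite: CasselsFrohlichANT1967, Ch. XV Lemma 4.1.2] [cite: WeilBNT1967, Ch. IV §3] -/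
theorem map_scaleY_eq_ideleNorm_smul [MeasurableSpace (AdeleRing (𝓞 L) L)] [BorelSpace (AdeleRing (𝓞 L) L)]
    (μY : Measure ↥(traceZeroAdele (↥(maximalRealSubfield L)) L (IsCMField.complexConj L))) [μY.IsAddHaarMeasure] [μY.Regular]
    (a : (AdeleRing (𝓞 L) L)ˣ)
    (hmem : ∀ y : ↥(traceZeroAdele (↥(maximalRealSubfield L)) L (IsCMField.complexConj L)),
      ((a⁻¹ : (AdeleRing (𝓞 L) L)ˣ) : AdeleRing (𝓞 L) L) * conjAdele (↥(maximalRealSubfield L)) L (IsCMField.complexConj L) ((a⁻¹ : (AdeleRing (𝓞 L) L)ˣ) : AdeleRing (𝓞 L) L) *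
        (y : AdeleRing (𝓞 L) L) ∈ traceZeroAdele (↥(maximalRealSubfield L)) L (IsCMField.complexConj L)) :
    μY.map (fun y : ↥(traceZeroAdele (↥(maximalRealSubfield L)) L (IsCMField.complexConj L)) =>
        (⟨((a⁻¹ : (AdeleRing (𝓞 L) L)ˣ) : AdeleRing (𝓞 L) L) * conjAdele (↥(maximalRealSubfield L)) L (IsCMField.complexConj L) ((a⁻¹ : (AdeleRing (𝓞 L) L)ˣ) : AdeleRing (𝓞 L) L) *
          (y : AdeleRing (𝓞 L) L), hmem y⟩ : ↥(traceZeroAdele (↥(maximalRealSubfield L)) L (IsCMField.complexConj L)))) =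
      ((IdeleClassGroup.ideleNorm L a : ℝ≥0) : ℝ≥0∞) • μY := by
  haveI : LocallyCompactSpace (AdeleRing (𝓞 L) L) := locallyCompactSpace_adeleRing' L
  haveI : LocallyCompactSpace (AdeleRing (𝓞 (↥(maximalRealSubfield L))) (↥(maximalRealSubfield L))) := locallyCompactSpace_adeleRing' (↥(maximalRealSubfield L))
  letI : MeasurableSpace (AdeleRing (𝓞 (↥(maximalRealSubfield L))) (↥(maximalRealSubfield L))) := borel _
  haveI : BorelSpace (AdeleRing (𝓞 (↥(maximalRealSubfield L))) (↥(maximalRealSubfield L))) := ⟨rfl⟩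
  obtain ⟨δ, hcδ, hδ⟩ := Literature.NumberTheory.Weil1982.UnitaryFinTopForm.exists_complexConj_eq_neg_ne_zero (L := L)
  set l : (AdeleRing (𝓞 L) L)ˣ := a⁻¹ * IsCMField.complexConj L • a⁻¹ with hl_def
  have hl : conjAdele (↥(maximalRealSubfield L)) L (IsCMField.complexConj L) (l : AdeleRing (𝓞 L) L) = l := conjAdele_normInv_eq a
  -- the scaling is `smulTraceZero l hl`
  have hfun : (fun y : ↥(traceZeroAdele (↥(maximalRealSubfield L)) L (IsCMField.complexConj L)) =>
      (⟨((a⁻¹ : (AdeleRing (𝓞 L) L)ˣ) : AdeleRing (𝓞 L) L) * conjAdele (↥(maximalRealSubfield L)) L (IsCMField.complexConj L) ((a⁻¹ : (AdeleRing (𝓞 L) L)ˣ) : AdeleRing (𝓞 L) L) *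
        (y : AdeleRing (𝓞 L) L), hmem y⟩ : ↥(traceZeroAdele (↥(maximalRealSubfield L)) L (IsCMField.complexConj L)))) = fun y => smulTraceZero l hl y := by
    funext y
    exact Subtype.ext rfl
  rw [hfun, map_smulTraceZero_eq l hl μY]
  -- the modulus: `traceZeroModulus l = ‖a⁻¹‖_L`
  obtain ⟨a₀, ha₀, hmod⟩ := exists_traceZeroModulus_eq_ideleNorm L (IsCMField.complexConj L) hcδ hδ l hl
  rw [hmod, ideleNorm_eq_of_ideleBaseChange_eq a a₀ ha₀, ← map_inv, inv_inv, ENNReal.smul_def]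

end Summit.HodgeConjecture.HodgeConjecture.Cruxes.HLiu418.K2LiuSkewLineModulus

end
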